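import Summits.HubbardSuperconductivity.HubbardSuperconductivity.Theorems.BcsKacWindowCoherenceWindowLROBulkSandwich
import Summits.HubbardSuperconductivity.HubbardSuperconductivity.Theorems.BcsKacWindowCoherenceWindowLROYangSide
import Summits.HubbardSuperconductivity.HubbardSuperconductivity.Theorems.CoherenceWindowLRO.Negative.LoadBearing
import Literature.Barriers.HubbardSuperconductivity.PureModelStripeCompetitionProofs

/-!
# Crux `CoherenceWindowLRO` (stmt-HubbardSuperconductivity-1319) — strategist census r1, companion

Kernel-checked companion of `STRATEGY-CENSUS.md` (redirect strategist r1, unit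
`cstrat-stmt-HubbardSuperconductivity-1319-r1`). It records, as theorems with no `sorry`, the two
formal facts the r1 census leans on beyond the s2 companion `StrategyCensusS2.lean`:

* §A **The F1 fault line as a typed lattice** (`## Decomposition` of the census). The refuters'
  standing objection F1 is that the crux pins ONE gap scale `Δ : ℝ → ℝ` for every doping of `[a,b]`.
  The doping-resolved repair replaces it by `Δ : ℝ → ℝ → ℝ` (`Δ δ U`). We type the repaired window
  `CoherenceWindowLROF1` and the repaired transfer `InfraredCompletionF1` and prove the lattice
  `CoherenceWindowLRO → CoherenceWindowLROF1`, `InfraredCompletionF1 → InfraredCompletion`,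
  `CoherenceWindowLROF1 → InfraredCompletionF1 → CoherenceWindowLRO` (the last through the tree's
  bulk sandwich `coherenceWindowLRO_of_bulkLRO_at_bcs_rate`). So the only typed split of the crux along
  F1 has as its hard child a statement CONTAINING the route's rank-4 crux `InfraredCompletion`
  (verdict `open-problem`, lead c15; strategist 1321-s1): it is a diagnostic, not a decomposition with
  a plan, and it is handed to the tenure planner (restatement R1) rather than filed.
* §B **Exponent clash with sub-Anderson no-condensate bounds** (`## Negation`). At body level: the
  window body with lower pin exponent `κ₂` is INCONSISTENT with a Yang no-condensate bound
  `λ_max(ρ₂(ψ)) ≤ C` holding at one doping `δ' ∈ [a,b]` on all even tori with `L² ≤ e^{κ'/U²}` as soon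
  as `κ' > 2κ₂` (`windowBody_false_of_subAnderson_exponent`). Reading: a proof of the crux must choose
  `κ₂ ≥ κ_A(δ)/2` for EVERY doping `δ` of its window, `κ_A(δ)` being any valid sub-Anderson exponent at
  `δ` — the formal shadow of "`Δ(U)` is pinned by the SMALLEST gap on `[a,b]`", i.e. of F1; and the
  negation route "refute the crux by a no-condensate theorem" needs a no-condensate exponent beating
  TWICE the crux's (freely chosen, arbitrarily large) `κ₂` — impossible, since the prover moves last.

Elementary bookkeeping over tree theorems (`coherenceWindowLRO_of_bulkLRO_at_bcs_rate`,
`re_expect_pairField_dWave_le_supRayleigh`, `exists_even_side_in_upper_window`,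
`exists_pos_exp_neg_div_sq_lt`, `exists_unit_isGroundStateInSector_hubbardTorus`). No definition of
a new object, no named fact, no physics. [folklore]
-/

-- the mandated namespace repeats `HubbardSuperconductivity` (single-problem summit, D-0017)
set_option linter.dupNamespace false

namespace Summit.HubbardSuperconductivity.HubbardSuperconductivity.Cruxes.CoherenceWindowLRO.StrategyCensusR1

open Matrix Literature.MathematicalPhysics.QuantumLattice
open Summit.HubbardSuperconductivity.HubbardSuperconductivity.Theses.BcsKacWindow
open Summit.HubbardSuperconductivity.HubbardSuperconductivity.Theorems.BcsKacWindow
open Summit.HubbardSuperconductivity.HubbardSuperconductivity.Theorems.CoherenceWindowLRO.Negative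

/-! ## §A  The F1 fault line as a typed lattice -/

/-- **Doping-resolved coherence window** (the F1 repair of the crux): verbatim `CoherenceWindowLRO`
except that the gap scale is a function of the doping too, `Δ : ℝ → ℝ → ℝ` (`Δ δ U`), pinned
`e^{-κ₂/U²} ≤ Δ δ U ≤ e^{-κ₁/U²}` for `δ ∈ [a,b]`, and the window is `s₀ ≤ Δ δ U · L ≤ s`. -/
def CoherenceWindowLROF1 : Prop :=
  ∃ (a b κ₁ κ₂ c₀ s₀ : ℝ) (Δ : ℝ → ℝ → ℝ), 0 < a ∧ a < b ∧ b < 1 / 2 ∧ 0 < κ₁ ∧ κ₁ ≤ κ₂ ∧ 0 < c₀ ∧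
    0 < s₀ ∧
    (∀ δ ∈ Set.Icc a b, ∀ U : ℝ, 0 < U →
      Real.exp (-(κ₂ / U ^ 2)) ≤ Δ δ U ∧ Δ δ U ≤ Real.exp (-(κ₁ / U ^ 2))) ∧
    ∀ s : ℝ, s₀ ≤ s → ∃ U₁ : ℝ, 0 < U₁ ∧ ∀ δ ∈ Set.Icc a b, ∀ U ∈ Set.Ioo (0:ℝ) U₁,
      ∀ (L : ℕ) [NeZero L], Even L → s₀ ≤ Δ δ U * L → Δ δ U * L ≤ s →
        ∀ ψ : Fock (Orb (FermionTorus 2 L)), star ψ ⬝ᵥ ψ = 1 →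
          IsGroundStateInSector (hubbardTorus 2 L 1 U) (2 * ⌊(1 - δ) * (L : ℝ) ^ 2 / 2⌋₊) 0 ψ →
            c₀ * Δ δ U ^ 2 ≤
              (expect ((pairField dWaveFormFactor L)ᴴ * pairField dWaveFormFactor L) ψ).re /
                (L : ℝ) ^ 4

/-- **Doping-resolved infrared completion** (the F1 repair of `InfraredCompletion`): the window ⇒
bulk transfer for doping-dependent gap scales `Δ δ U`. -/
def InfraredCompletionF1 : Prop :=
  ∀ (a b κ₁ κ₂ c₀ s₀ : ℝ) (Δ : ℝ → ℝ → ℝ), 0 < a → a < b → b < 1 / 2 → 0 < κ₁ → κ₁ ≤ κ₂ → 0 < c₀ →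
    0 < s₀ →
    (∀ δ ∈ Set.Icc a b, ∀ U : ℝ, 0 < U →
      Real.exp (-(κ₂ / U ^ 2)) ≤ Δ δ U ∧ Δ δ U ≤ Real.exp (-(κ₁ / U ^ 2))) →
    (∀ s : ℝ, s₀ ≤ s → ∃ U₁ : ℝ, 0 < U₁ ∧ ∀ δ ∈ Set.Icc a b, ∀ U ∈ Set.Ioo (0:ℝ) U₁,
      ∀ (L : ℕ) [NeZero L], Even L → s₀ ≤ Δ δ U * L → Δ δ U * L ≤ s →
        ∀ ψ : Fock (Orb (FermionTorus 2 L)), star ψ ⬝ᵥ ψ = 1 →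
          IsGroundStateInSector (hubbardTorus 2 L 1 U) (2 * ⌊(1 - δ) * (L : ℝ) ^ 2 / 2⌋₊) 0 ψ →
            c₀ * Δ δ U ^ 2 ≤
              (expect ((pairField dWaveFormFactor L)ᴴ * pairField dWaveFormFactor L) ψ).re /
                (L : ℝ) ^ 4) →
    ∃ c₁ s₁ U₁ : ℝ, 0 < c₁ ∧ 0 < U₁ ∧ ∀ δ ∈ Set.Icc a b, ∀ U ∈ Set.Ioo (0:ℝ) U₁,
      ∀ (L : ℕ) [NeZero L], Even L → s₁ ≤ Δ δ U * L →
        ∀ ψ : Fock (Orb (FermionTorus 2 L)), star ψ ⬝ᵥ ψ = 1 →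
          IsGroundStateInSector (hubbardTorus 2 L 1 U) (2 * ⌊(1 - δ) * (L : ℝ) ^ 2 / 2⌋₊) 0 ψ →
            c₁ * Δ δ U ^ 2 ≤
              (expect ((pairField dWaveFormFactor L)ᴴ * pairField dWaveFormFactor L) ψ).re /
                (L : ℝ) ^ 4

/-- The typed crux implies its F1 repair (take `Δ δ U := Δ U`): the repaired window is WEAKER. -/
theorem coherenceWindowLROF1_of_coherenceWindowLRO (h : CoherenceWindowLRO) :
    CoherenceWindowLROF1 := by
  obtain ⟨a, b, κ₁, κ₂, c₀, s₀, Δ, ha, hab, hb, hκ₁, hκ₁₂, hc₀, hs₀, hpin, hwin⟩ := h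
  exact ⟨a, b, κ₁, κ₂, c₀, s₀, fun _ U => Δ U, ha, hab, hb, hκ₁, hκ₁₂, hc₀, hs₀,
    fun _ _ U hU => hpin U hU, hwin⟩

/-- The F1-repaired transfer implies the typed transfer (instantiate at a doping-constant `Δ`): the
repaired transfer is STRONGER, in particular it contains the route's rank-4 crux `InfraredCompletion`
(verdict `open-problem`). -/
theorem infraredCompletion_of_infraredCompletionF1 (h : InfraredCompletionF1) :
    InfraredCompletion := by
  intro a b κ₁ κ₂ c₀ s₀ Δ ha hab hb hκ₁ hκ₁₂ hc₀ hs₀ hpin hwin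
  exact h a b κ₁ κ₂ c₀ s₀ (fun _ U => Δ U) ha hab hb hκ₁ hκ₁₂ hc₀ hs₀ (fun _ _ U hU => hpin U hU) hwin

/-- **The F1 split closes onto the typed crux.** The doping-resolved window together with the
doping-resolved transfer gives bulk order `≥ c₁ (Δ δ U)² ≥ c₁ e^{-2κ₂/U²}` on every even torus with
`L ≥ max s₁ 1 · e^{κ₂/U²}` (for then `Δ δ U · L ≥ e^{-κ₂/U²} L ≥ max s₁ 1 ≥ s₁`), which is the
hypothesis of the tree's bulk sandwich `coherenceWindowLRO_of_bulkLRO_at_bcs_rate`; hence the typed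
crux, with the doping-UNIFORM scale `e^{-κ₂/U²}`. -/
theorem coherenceWindowLRO_of_F1split (hW : CoherenceWindowLROF1) (hI : InfraredCompletionF1) :
    CoherenceWindowLRO := by
  obtain ⟨a, b, κ₁, κ₂, c₀, s₀, Δ, ha, hab, hb, hκ₁, hκ₁₂, hc₀, hs₀, hpin, hwin⟩ := hW
  obtain ⟨c₁, s₁, U₁, hc₁, hU₁, hbulk⟩ :=
    hI a b κ₁ κ₂ c₀ s₀ Δ ha hab hb hκ₁ hκ₁₂ hc₀ hs₀ hpin hwin
  have hκ₂ : 0 < κ₂ := lt_of_lt_of_le hκ₁ hκ₁₂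
  have hC : 0 < max s₁ 1 := lt_of_lt_of_le one_pos (le_max_right _ _)
  refine coherenceWindowLRO_of_bulkLRO_at_bcs_rate
    ⟨a, b, κ₂, c₁, max s₁ 1, U₁, ha, hab, hb, hκ₂, hc₁, hC, hU₁, ?_⟩
  intro δ hδ U hU L _ hE hCL ψ hψ hgs
  have hUpos : 0 < U := hU.1
  obtain ⟨hlo, -⟩ := hpin δ hδ U hUpos
  have hepos : 0 < Real.exp (-(κ₂ / U ^ 2)) := Real.exp_pos _
  have hΔpos : 0 < Δ δ U := lt_of_lt_of_le hepos hlo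
  -- the onset: `s₁ ≤ Δ δ U · L`
  have hexp : Real.exp (-(κ₂ / U ^ 2)) * Real.exp (κ₂ / U ^ 2) = 1 := by
    rw [← Real.exp_add, neg_add_cancel, Real.exp_zero]
  have hL0 : (0 : ℝ) ≤ (L : ℝ) := Nat.cast_nonneg L
  have hs₁ : s₁ ≤ Δ δ U * L := by
    calc s₁ ≤ max s₁ 1 := le_max_left _ _
      _ = Real.exp (-(κ₂ / U ^ 2)) * (max s₁ 1 * Real.exp (κ₂ / U ^ 2)) := by
          rw [mul_comm (max s₁ 1), ← mul_assoc, hexp, one_mul]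
      _ ≤ Real.exp (-(κ₂ / U ^ 2)) * L := mul_le_mul_of_nonneg_left hCL hepos.le
      _ ≤ Δ δ U * L := mul_le_mul_of_nonneg_right hlo hL0
  have key := hbulk δ hδ U hU L hE hs₁ ψ hψ hgs
  have hsq : Real.exp (-(κ₂ / U ^ 2)) ^ 2 ≤ Δ δ U ^ 2 := pow_le_pow_left₀ hepos.le hlo 2
  calc c₁ * Real.exp (-(κ₂ / U ^ 2)) ^ 2 ≤ c₁ * Δ δ U ^ 2 :=
        mul_le_mul_of_nonneg_left hsq hc₁.le
    _ ≤ _ := key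

/-! ## §B  Exponent clash with sub-Anderson no-condensate bounds -/

/-- **The window body with lower-pin exponent `κ₂` contradicts a Yang no-condensate bound with
exponent `κ' > 2κ₂` at any doping of its window.** Hypotheses: the pins and the window clause of
`CoherenceWindowLRO` for data `(a,b,κ₁,κ₂,c₀,s₀,Δ)` (body level, `0 < a`), and, at one doping
`δ' ∈ [a,b]`, a no-condensate bound of the shape of `NoCondensateBelowAndersonLength`:
`λ_max(ρ₂(ψ)) = (twoParticleRDM ψ).supRayleigh ≤ C` for every normalised sector ground state on
every even torus with `L² ≤ e^{κ'/U²}`, `U ∈ (0,U₀')`. Conclusion: `False` when `2κ₂ < κ'`.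
Proof: at the window top `s = max (2s₀) (max 1 (64(|C|+1)/(9c₀)))` and below
`min (U₁(s), U₀', U₂)` (`U₂` making `s² < e^{(κ'-2κ₂)/U²}`), `exists_even_side_in_upper_window`
gives a datum `(U, L = 2m)` with `3s/4 < Δ(U)L ≤ s`; a normalised sector ground state exists
(`exists_unit_isGroundStateInSector_hubbardTorus`); the window clause and Yang's bound
`Re⟨Δ_d†Δ_d⟩ ≤ 4L² λ_max` (`re_expect_pairField_dWave_le_supRayleigh`) give
`c₀ (Δ(U)L)² ≤ 4 λ_max`, while `L ≤ s/Δ(U) ≤ s e^{κ₂/U²}` puts `L² ≤ s² e^{2κ₂/U²} < e^{κ'/U²}`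
inside the no-condensate range, so `λ_max ≤ C`: `9c₀s²/16 < 4C`, contradicting the choice of `s`.
[folklore] -/
theorem windowBody_false_of_subAnderson_exponent {a b κ₁ κ₂ c₀ s₀ : ℝ} {Δ : ℝ → ℝ}
    (ha : 0 < a) (hκ₁ : 0 < κ₁) (hc₀ : 0 < c₀) (hs₀ : 0 < s₀)
    (hpin : ∀ U : ℝ, 0 < U → Real.exp (-(κ₂ / U ^ 2)) ≤ Δ U ∧ Δ U ≤ Real.exp (-(κ₁ / U ^ 2)))
    (hwin : ∀ s : ℝ, s₀ ≤ s → ∃ U₁ : ℝ, 0 < U₁ ∧ ∀ δ ∈ Set.Icc a b, ∀ U ∈ Set.Ioo (0:ℝ) U₁,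
      ∀ (L : ℕ) [NeZero L], Even L → s₀ ≤ Δ U * L → Δ U * L ≤ s →
        ∀ ψ : Fock (Orb (FermionTorus 2 L)), star ψ ⬝ᵥ ψ = 1 →
          IsGroundStateInSector (hubbardTorus 2 L 1 U) (2 * ⌊(1 - δ) * (L : ℝ) ^ 2 / 2⌋₊) 0 ψ →
            c₀ * Δ U ^ 2 ≤
              (expect ((pairField dWaveFormFactor L)ᴴ * pairField dWaveFormFactor L) ψ).re /
                (L : ℝ) ^ 4)
    {δ' κ' C U₀' : ℝ} (hδ' : δ' ∈ Set.Icc a b) (hκ' : 2 * κ₂ < κ') (hU₀' : 0 < U₀')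
    (hnc : ∀ U ∈ Set.Ioo (0:ℝ) U₀', ∀ (L : ℕ) [NeZero L], Even L →
      (L : ℝ) ^ 2 ≤ Real.exp (κ' / U ^ 2) →
        ∀ ψ : Fock (Orb (FermionTorus 2 L)), star ψ ⬝ᵥ ψ = 1 →
          IsGroundStateInSector (hubbardTorus 2 L 1 U) (2 * ⌊(1 - δ') * (L : ℝ) ^ 2 / 2⌋₊) 0 ψ →
            (twoParticleRDM ψ).supRayleigh ≤ C) :
    False := by
  -- the window top
  set s : ℝ := max (2 * s₀) (max 1 (64 * (|C| + 1) / (9 * c₀))) with hsdef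
  have hs₀s : s₀ ≤ s := le_trans (by linarith) (le_max_left _ _)
  have h1s : 1 ≤ s := le_trans (le_max_left _ _) (le_max_right _ _)
  have hspos : 0 < s := lt_of_lt_of_le one_pos h1s
  have hbigs : 64 * (|C| + 1) / (9 * c₀) ≤ s := le_trans (le_max_right _ _) (le_max_right _ _)
  obtain ⟨U₁, hU₁, hcrux⟩ := hwin s hs₀s
  -- `U₂`: below it, `s² < e^{(κ' - 2κ₂)/U²}`
  have hgap : 0 < κ' - 2 * κ₂ := by linarith
  obtain ⟨U₂, hU₂, hsmall⟩ :=
    exists_pos_exp_neg_div_sq_lt hgap (show 0 < 1 / s ^ 2 by positivity)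
  -- the datum
  set Us : ℝ := min U₁ (min U₀' U₂) with hUdef
  have hUs : 0 < Us := lt_min hU₁ (lt_min hU₀' hU₂)
  have hpin' : ∀ U : ℝ, 0 < U → 0 < Δ U ∧ Δ U ≤ Real.exp (-(κ₁ / U ^ 2)) := fun U hU =>
    ⟨lt_of_lt_of_le (Real.exp_pos _) (hpin U hU).1, (hpin U hU).2⟩
  obtain ⟨U, hUpos, hUlt, m, hm2, hhi, hlo⟩ :=
    exists_even_side_in_upper_window hκ₁ hpin' hspos hUs
  have hUU₁ : U < U₁ := lt_of_lt_of_le hUlt (min_le_left _ _)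
  have hUU₀' : U < U₀' := lt_of_lt_of_le hUlt ((min_le_right _ _).trans (min_le_left _ _))
  have hUU₂ : U < U₂ := lt_of_lt_of_le hUlt ((min_le_right _ _).trans (min_le_right _ _))
  set L : ℕ := 2 * m with hLdef
  haveI : NeZero L := ⟨by omega⟩
  have hE : Even L := ⟨m, by omega⟩
  have hL3 : 3 ≤ L := by omega
  have hLpos : (0 : ℝ) < (L : ℝ) := by positivity
  obtain ⟨hΔpos, -⟩ := hpin' U hUpos
  obtain ⟨hΔlo, -⟩ := hpin U hUpos
  -- window membership
  have hs₀L : s₀ ≤ Δ U * (L : ℝ) := by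
    have : 2 * s₀ ≤ s := le_max_left _ _
    linarith
  -- a normalised sector ground state exists
  have hδ'1 : -1 ≤ δ' := by linarith [hδ'.1]
  obtain ⟨ψ, hψ, hgs⟩ :=
    Literature.Barriers.HubbardSuperconductivity.exists_unit_isGroundStateInSector_hubbardTorus U L
      ⌊(1 - δ') * (L : ℝ) ^ 2 / 2⌋₊
      (Literature.Barriers.HubbardSuperconductivity.natFloor_filling_le_sq hδ'1 L)
  -- the window clause at the datum
  have hwinL := hcrux δ' hδ' U ⟨hUpos, hUU₁⟩ L hE hs₀L hhi ψ hψ hgs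
  -- Yang's bound
  have hY := re_expect_pairField_dWave_le_supRayleigh L hL3 ψ
  -- the datum lies in the no-condensate range: `L² ≤ e^{κ'/U²}`
  have hL2 : (L : ℝ) ^ 2 ≤ Real.exp (κ' / U ^ 2) := by
    have hLle : (L : ℝ) ≤ s * Real.exp (κ₂ / U ^ 2) := by
      -- `Δ U · L ≤ s` and `e^{-κ₂/U²} ≤ Δ U`
      have h1 : Real.exp (-(κ₂ / U ^ 2)) * (L : ℝ) ≤ s := le_trans
        (mul_le_mul_of_nonneg_right hΔlo hLpos.le) hhi
      have hexp : Real.exp (-(κ₂ / U ^ 2)) * Real.exp (κ₂ / U ^ 2) = 1 := by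
        rw [← Real.exp_add, neg_add_cancel, Real.exp_zero]
      have hepos : 0 < Real.exp (κ₂ / U ^ 2) := Real.exp_pos _
      calc (L : ℝ) = Real.exp (-(κ₂ / U ^ 2)) * (L : ℝ) * Real.exp (κ₂ / U ^ 2) := by
            rw [mul_comm (Real.exp _) (L : ℝ), mul_assoc, hexp, mul_one]
        _ ≤ s * Real.exp (κ₂ / U ^ 2) := mul_le_mul_of_nonneg_right h1 hepos.le
    have hs2 : s ^ 2 < Real.exp ((κ' - 2 * κ₂) / U ^ 2) := by
      have h := hsmall U hUpos hUU₂
      -- `e^{-(κ'-2κ₂)/U²} < 1/s²`  ⇒  `s² < e^{(κ'-2κ₂)/U²}`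
      have hepos : 0 < Real.exp (-((κ' - 2 * κ₂) / U ^ 2)) := Real.exp_pos _
      have hs2pos : 0 < s ^ 2 := by positivity
      have h' : s ^ 2 * Real.exp (-((κ' - 2 * κ₂) / U ^ 2)) < 1 := by
        have := mul_lt_mul_of_pos_left h hs2pos
        rwa [mul_one_div_cancel hs2pos.ne'] at this
      have hexp : Real.exp (-((κ' - 2 * κ₂) / U ^ 2)) * Real.exp ((κ' - 2 * κ₂) / U ^ 2) = 1 := by
        rw [← Real.exp_add, neg_add_cancel, Real.exp_zero]
      have hepos' : 0 < Real.exp ((κ' - 2 * κ₂) / U ^ 2) := Real.exp_pos _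
      calc s ^ 2 = s ^ 2 * Real.exp (-((κ' - 2 * κ₂) / U ^ 2)) *
            Real.exp ((κ' - 2 * κ₂) / U ^ 2) := by rw [mul_assoc, hexp, mul_one]
        _ < 1 * Real.exp ((κ' - 2 * κ₂) / U ^ 2) := mul_lt_mul_of_pos_right h' hepos'
        _ = _ := one_mul _
    have hprod : s ^ 2 * Real.exp (κ₂ / U ^ 2) ^ 2 ≤ Real.exp (κ' / U ^ 2) := by
      have hsq : Real.exp (κ₂ / U ^ 2) ^ 2 = Real.exp (2 * κ₂ / U ^ 2) := by
        rw [sq, ← Real.exp_add]; congr 1; ring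
      rw [hsq]
      have hsplit : Real.exp (κ' / U ^ 2) =
          Real.exp ((κ' - 2 * κ₂) / U ^ 2) * Real.exp (2 * κ₂ / U ^ 2) := by
        rw [← Real.exp_add]; congr 1; ring
      rw [hsplit]
      exact mul_le_mul_of_nonneg_right hs2.le (Real.exp_pos _).le
    calc (L : ℝ) ^ 2 ≤ (s * Real.exp (κ₂ / U ^ 2)) ^ 2 := pow_le_pow_left₀ hLpos.le hLle 2
      _ = s ^ 2 * Real.exp (κ₂ / U ^ 2) ^ 2 := by ring
      _ ≤ Real.exp (κ' / U ^ 2) := hprod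
  have hNC := hnc U ⟨hUpos, hUU₀'⟩ L hE hL2 ψ hψ hgs
  -- arithmetic: `c₀ (Δ U · L)² ≤ 4 λ_max ≤ 4C` but `(Δ U · L)² > 9s²/16` and `9 c₀ s² ≥ 64(|C|+1)`
  have hL4 : (0 : ℝ) < (L : ℝ) ^ 4 := by positivity
  rw [le_div_iff₀ hL4] at hwinL
  set X : ℝ := Δ U * (L : ℝ) with hXdef
  have hXlo : 3 * s / 4 < X := hlo
  have hmain : c₀ * X ^ 2 * (L : ℝ) ^ 2 ≤ 4 * (L : ℝ) ^ 2 * C := by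
    calc c₀ * X ^ 2 * (L : ℝ) ^ 2 = c₀ * Δ U ^ 2 * (L : ℝ) ^ 4 := by rw [hXdef]; ring
      _ ≤ _ := hwinL
      _ ≤ 4 * (L : ℝ) ^ 2 * (twoParticleRDM ψ).supRayleigh := hY
      _ ≤ 4 * (L : ℝ) ^ 2 * C := mul_le_mul_of_nonneg_left hNC (by positivity)
  have hL2pos : (0 : ℝ) < (L : ℝ) ^ 2 := by positivity
  have hmain' : c₀ * X ^ 2 ≤ 4 * C := by
    have : c₀ * X ^ 2 * (L : ℝ) ^ 2 ≤ 4 * C * (L : ℝ) ^ 2 := by linarith [hmain]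
    exact le_of_mul_le_mul_right this hL2pos
  -- `9 c₀ s² ≥ 64 (|C| + 1)`
  have h9 : 64 * (|C| + 1) ≤ 9 * c₀ * s := by
    have := (div_le_iff₀ (by positivity : (0:ℝ) < 9 * c₀)).1 hbigs
    linarith
  have hss : s ≤ s ^ 2 := by nlinarith
  have hC : C ≤ |C| := le_abs_self C
  have hXsq : (3 * s / 4) ^ 2 < X ^ 2 := by
    have h0 : 0 ≤ 3 * s / 4 := by positivity
    exact pow_lt_pow_left₀ hXlo h0 two_ne_zero
  nlinarith [hmain', h9, hss, hC, hXsq, hc₀, mul_le_mul_of_nonneg_left hss (by positivity : (0:ℝ) ≤ 9 * c₀)]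

end Summit.HubbardSuperconductivity.HubbardSuperconductivity.Cruxes.CoherenceWindowLRO.StrategyCensusR1
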